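import Literature.NumberTheory.Automorphic.AdelicHeightZetaUniform
import HarnessLib

/-!
# Compact sets of finite adeles have bounded valuations, and a positive integer of prescribed
# depth at finitely many places (two generic letters for the level-depth step of the truncated
# kernel on `U(3)`)

Topic `NumberTheory/Automorphic`; namespace `Literature.NumberTheory.Automorphic`. Proof file:
theorems only (no definition, no named fact, no instance, no `sorry`); imports = tree + Mathlib.

THE POINT (Cassels–Fröhlich, Ch. II §14–§16 «restricted topological product»; Garrett (2018),
Thm. 2.2.2). Two elementary facts about the finite adele ring `𝔸_K^∞ = Πʳ_v (K_v, 𝒪_v)` of a number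
field, in the valuation currency `Valued.v : K_v → ℤᵐ⁰`, `WithZero.exp`:
* (A1) a COMPACT set `C ⊆ 𝔸_K^∞` is integral outside a finite set `T` of places (★
  `exists_finset_forall_mem_adicCompletionIntegers_of_isCompact`) AND has all its local components
  of valuation `≤ exp n` for one `n : ℕ` (at each `v ∈ T` the compact image of `C` in `K_v` lies in
  one of the increasing open balls `{y | v(y) ≤ v(π_v^{-j})} = {v ≤ exp j}`);
* (A2) for a finite set `T` of places, an exponent `n` and non-zero target radii `r v`, `v ∈ T`, there
  is a positive integer `m` (a power of `N = ∏_{v ∈ T} N(𝔭_v)`, `N ∈ 𝔭_v`) with `v(m) ≤ 1` at every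
  finite place and `v(m) · exp n ≤ r v` at the places of `T` — the «level depth» used to push a
  compact piece of the Heisenberg group into a principal congruence subgroup.

* §1 `exists_finset_nat_forall_valued_le_of_isCompact` (A1).
* §2 `exists_natCast_valued_mul_exp_le` (A2).

## References

* J. W. S. Cassels, A. Fröhlich (eds.), *Algebraic Number Theory* (1967), Ch. II §§14–16
  [CasselsFrohlichANT1967].
* P. Garrett, *Modern Analysis of Automorphic Forms by Example* (2018), Thm. 2.2.2 [Garrett2018].
-/

set_option autoImplicit false

noncomputable section

open NumberField IsDedekindDomain Set WithZero

namespace Literature.NumberTheory.Automorphic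

variable {K : Type} [Field K] [NumberField K]

/-! ## §1 Compact sets of finite adeles have uniformly bounded valuations -/

/-- At one place: a compact set of finite adeles has `v`-components of valuation `≤ exp j` for one
`j : ℕ` (the open balls `{y | v(y) ≤ v(π⁻ʲ)}` increase to `K_v`). [cite: CasselsFrohlichANT1967, Ch. II §16] -/
theorem exists_nat_forall_valued_apply_le_of_isCompact {C : Set (FiniteAdeleRing (𝓞 K) K)}
    (hC : IsCompact C) (v : HeightOneSpectrum (𝓞 K)) :
    ∃ j : ℕ, ∀ x ∈ C, Valued.v (x v) ≤ exp (j : ℤ) := by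
  classical
  -- a uniformizer at `v` and the elements `z j = π^{-j}` of valuation `exp j`
  obtain ⟨π, hπ⟩ := v.valuation_exists_uniformizer (K := K)
  have hπ0 : π ≠ 0 := by
    intro h
    rw [h, map_zero] at hπ
    exact WithZero.zero_ne_coe hπ
  set z : ℕ → v.adicCompletion K := fun j => algebraMap K (v.adicCompletion K) (π⁻¹ ^ j) with hz
  have hval : ∀ c : K, Valued.v (algebraMap K (v.adicCompletion K) c) = v.valuation K c :=
    fun c => HeightOneSpectrum.valuedAdicCompletion_eq_valuation' v c
  have hzv : ∀ j : ℕ, Valued.v (z j) = exp (j : ℤ) := by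
    intro j
    rw [hz]
    simp only
    rw [hval, map_pow, map_inv₀, hπ, ← exp_neg, neg_neg, ← exp_nsmul, nsmul_eq_mul, mul_one]
  have hz0 : ∀ j : ℕ, Valued.v.restrict (z j) ≠ 0 := by
    intro j h
    have h' : Valued.v (z j) = 0 := (Valuation.restrict_pos_iff (v := Valued.v) (z j)).not.mp
      (by rw [h]; exact lt_irrefl 0) |> fun hh => by
        by_contra hne
        exact hh (zero_lt_iff.mpr hne)
    rw [hzv] at h'
    exact exp_ne_zero h'
  -- the open sets `U j = {x | v(x_v) ≤ exp j}`
  set U : ℕ → Set (FiniteAdeleRing (𝓞 K) K) := fun j => {x | Valued.v (x v) ≤ Valued.v (z j)} with hU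
  have hUo : ∀ j, IsOpen (U j) := by
    intro j
    have h1 : IsOpen {y : v.adicCompletion K | Valued.v y ≤ Valued.v (z j)} := by
      simpa only [Valuation.restrict_le_iff] using
        Valued.isOpen_closedBall (v.adicCompletion K) (hz0 j)
    exact h1.preimage (RestrictedProduct.continuous_eval v)
  have hcov : C ⊆ ⋃ j, U j := by
    intro x _
    refine Set.mem_iUnion.2 ⟨(log (Valued.v (x v))).toNat, ?_⟩
    change Valued.v (x v) ≤ Valued.v (z _)
    rw [hzv]
    exact le_exp_of_log_le (Int.self_le_toNat _)
  have hdir : Directed (· ⊆ ·) U := by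
    refine Monotone.directed_le fun i j hij x hx => ?_
    change Valued.v (x v) ≤ Valued.v (z j)
    have hx' : Valued.v (x v) ≤ Valued.v (z i) := hx
    rw [hzv] at hx' ⊢
    exact hx'.trans (exp_le_exp.2 (by exact_mod_cast hij))
  obtain ⟨j, hj⟩ := hC.elim_directed_cover U hUo hcov hdir
  refine ⟨j, fun x hx => ?_⟩
  have h := hj hx
  change Valued.v (x v) ≤ Valued.v (z j) at h
  rwa [hzv] at h

/-- **(A1) A COMPACT SET OF FINITE ADELES IS INTEGRAL OFF A FINITE SET OF PLACES AND HAS UNIFORMLY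
BOUNDED VALUATIONS**: for compact `C ⊆ 𝔸_K^∞` there are a finite `T` and `n : ℕ` with `v(x_v) ≤ 1`
for `v ∉ T` and `v(x_v) ≤ exp n` for all `v`, for every `x ∈ C`. [cite: Garrett2018, Thm. 2.2.2] -/
theorem exists_finset_nat_forall_valued_le_of_isCompact {C : Set (FiniteAdeleRing (𝓞 K) K)}
    (hC : IsCompact C) :
    ∃ T : Finset (HeightOneSpectrum (𝓞 K)), ∃ n : ℕ,
      (∀ x ∈ C, ∀ v : HeightOneSpectrum (𝓞 K), v ∉ T → Valued.v (x v) ≤ 1) ∧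
      (∀ x ∈ C, ∀ v : HeightOneSpectrum (𝓞 K), Valued.v (x v) ≤ exp (n : ℤ)) := by
  classical
  obtain ⟨T, hT⟩ := exists_finset_forall_mem_adicCompletionIntegers_of_isCompact K hC
  have hint : ∀ x ∈ C, ∀ v : HeightOneSpectrum (𝓞 K), v ∉ T → Valued.v (x v) ≤ 1 :=
    fun x hx v hv => (HeightOneSpectrum.mem_adicCompletionIntegers (𝓞 K) K v).mp (hT x hx v hv)
  choose j hj using fun v : HeightOneSpectrum (𝓞 K) => exists_nat_forall_valued_apply_le_of_isCompact hC v
  refine ⟨T, T.sup j, hint, fun x hx v => ?_⟩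
  by_cases hv : v ∈ T
  · exact (hj v x hx).trans (exp_le_exp.2 (by exact_mod_cast Finset.le_sup hv))
  · exact (hint x hx v hv).trans (by rw [← exp_zero]; exact exp_le_exp.2 (by positivity))

/-! ## §2 A positive integer of prescribed depth at finitely many places -/

/-- The natural number `N = ∏_{v ∈ T} N(𝔭_v)` is a `v`-adic non-unit at every `v ∈ T`:
`v(N) ≤ exp (−1)` in `K_v`. [cite: CasselsFrohlichANT1967, Ch. II §16] -/
private theorem valued_natCast_prod_absNorm_le (T : Finset (HeightOneSpectrum (𝓞 K)))
    {v : HeightOneSpectrum (𝓞 K)} (hv : v ∈ T) :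
    Valued.v (((∏ w ∈ T, Ideal.absNorm w.asIdeal : ℕ) : v.adicCompletion K)) ≤ exp (-1 : ℤ) := by
  classical
  have hmem : ((∏ w ∈ T, Ideal.absNorm w.asIdeal : ℕ) : 𝓞 K) ∈ v.asIdeal := by
    rw [← Finset.mul_prod_erase T (fun w => Ideal.absNorm w.asIdeal) hv, Nat.cast_mul]
    exact Ideal.mul_mem_right _ _ (Ideal.absNorm_mem v.asIdeal)
  have hcast : ((∏ w ∈ T, Ideal.absNorm w.asIdeal : ℕ) : v.adicCompletion K) =
      algebraMap K (v.adicCompletion K) (algebraMap (𝓞 K) K ((∏ w ∈ T, Ideal.absNorm w.asIdeal : ℕ) : 𝓞 K)) := by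
    rw [map_natCast, map_natCast]
  have hval : ∀ c : K, Valued.v (algebraMap K (v.adicCompletion K) c) = v.valuation K c :=
    fun c => HeightOneSpectrum.valuedAdicCompletion_eq_valuation' v c
  rw [hcast, hval, HeightOneSpectrum.valuation_of_algebraMap]
  have hlt := (v.intValuation_lt_one_iff_mem _).2 hmem
  -- `intValuation r < 1 ⇒ ≤ exp (-1)` (values of non-zero elements are `exp` of integers)
  by_cases h0 : v.intValuation ((∏ w ∈ T, Ideal.absNorm w.asIdeal : ℕ) : 𝓞 K) = 0
  · rw [h0]; exact zero_le
  · rw [← exp_log h0] at hlt ⊢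
    rw [← exp_zero, exp_lt_exp] at hlt
    exact exp_le_exp.2 (by omega)

/-- Every natural number is a `v`-adic integer: `v(m) ≤ 1` in `K_v`. [cite: CasselsFrohlichANT1967, Ch. II §16] -/
private theorem valued_natCast_le_one (v : HeightOneSpectrum (𝓞 K)) (m : ℕ) :
    Valued.v ((m : v.adicCompletion K)) ≤ 1 := by
  have hcast : ((m : ℕ) : v.adicCompletion K) =
      algebraMap K (v.adicCompletion K) (algebraMap (𝓞 K) K (m : 𝓞 K)) := by
    rw [map_natCast, map_natCast]
  have hval : ∀ c : K, Valued.v (algebraMap K (v.adicCompletion K) c) = v.valuation K c :=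
    fun c => HeightOneSpectrum.valuedAdicCompletion_eq_valuation' v c
  rw [hcast, hval, HeightOneSpectrum.valuation_of_algebraMap]
  exact v.intValuation_le_one _

/-- **(A2) A POSITIVE INTEGER OF PRESCRIBED DEPTH AT FINITELY MANY PLACES**: for a finite set `T` of
places, `n : ℕ` and non-zero radii `r v` (`v ∈ T`) there is `m ≠ 0` in `ℕ` with `v(m) ≤ 1` at
every finite place and `v(m) · exp n ≤ r v` for `v ∈ T` (`m = N^k`, `N = ∏_{v ∈ T} N(𝔭_v)`).
[cite: CasselsFrohlichANT1967, Ch. II §16] -/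
theorem exists_natCast_valued_mul_exp_le (T : Finset (HeightOneSpectrum (𝓞 K))) (n : ℕ)
    (r : HeightOneSpectrum (𝓞 K) → ℤᵐ⁰) (hr : ∀ v ∈ T, r v ≠ 0) :
    ∃ m : ℕ, m ≠ 0 ∧ (∀ v : HeightOneSpectrum (𝓞 K), Valued.v ((m : v.adicCompletion K)) ≤ 1) ∧
      ∀ v ∈ T, Valued.v ((m : v.adicCompletion K)) * exp (n : ℤ) ≤ r v := by
  classical
  set N : ℕ := ∏ w ∈ T, Ideal.absNorm w.asIdeal with hN
  have hN0 : N ≠ 0 := by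
    rw [hN, Finset.prod_ne_zero_iff]
    intro w _ h
    exact w.ne_bot (Ideal.absNorm_eq_zero_iff.1 h)
  -- the exponent: `k ≥ n − log (r v)` for every `v ∈ T`
  set k : ℕ := T.sup fun v => ((n : ℤ) - log (r v)).toNat with hk
  refine ⟨N ^ k, pow_ne_zero _ hN0, fun v => ?_, fun v hv => ?_⟩
  · rw [Nat.cast_pow]
    rw [map_pow]
    exact pow_le_one₀ (zero_le) (valued_natCast_le_one v N)
  · have hkv : ((n : ℤ) - log (r v)).toNat ≤ k := Finset.le_sup (f := fun v => ((n : ℤ) - log (r v)).toNat) hv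
    have hle : (n : ℤ) - log (r v) ≤ k := (Int.self_le_toNat _).trans (by exact_mod_cast hkv)
    rw [Nat.cast_pow, map_pow]
    have hpow : Valued.v ((N : v.adicCompletion K)) ^ k ≤ exp (-1 : ℤ) ^ k :=
      pow_le_pow_left₀ (zero_le) (valued_natCast_prod_absNorm_le T hv) k
    calc Valued.v ((N : v.adicCompletion K)) ^ k * exp (n : ℤ)
        ≤ exp (-1 : ℤ) ^ k * exp (n : ℤ) := mul_le_mul_left hpow _
      _ = exp (-(k : ℤ) + n) := by rw [← exp_nsmul, exp_add, nsmul_eq_mul, mul_neg, mul_one]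
      _ ≤ exp (log (r v)) := exp_le_exp.2 (by omega)
      _ = r v := exp_log (hr v hv)

end Literature.NumberTheory.Automorphic

end
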